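import Mathlib
import Summits.PneNP.PneNP.Theorems.AeaCutRectanglesCriticalSupport

/-!
# IdeasR2s1g23 — seat 1, gen 23 (crux `FoolingMeasure`, stmt-PneNP-19727): the affine-kernel calculus
past rank `n − 1`, and the PRIVATE-POINT BOUND

FRONTIER restricted-model rung (AEA cut rectangles vs NON-3-COL); nothing here bears on P vs NP.
Companion of `IDEATION-CENSUS-r2s1g23.md` §2 (species Λ).  PROVED here (no sorry; axioms propext /
Classical.choice / Quot.sound): `mem_triangleKernel_of_proper` (proper colourings lie in the kernel),
`privatePoint_of_critical` (a critical extra edge yields a private kernel point), `privatePoint_bound_sq` /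
`card_le_of_hasPrivatePoints` (a private-point family in `𝔽₃^m` has `≤ m² + 1` members — polynomial method),
and the graph corollary `extraEdges_le_sq` (a 4-edge-critical edge set has at most `m² + 1` edges outside
the triples of `H`, `m = dim triangleKernel H`).  Statements only (`def … : Prop`): the sharp bound
`PrivatePointBound` (`(m+1)(m+2)/2`), `TrianglePackingSparsity` (sharp graph form), `IsotropicTriplesPrivate`
(tightness in order), `NonOrthogonalCount` (counting core of the realisability wall).

Setting (extends `IdeasR2s2g12`, the Z₃-syndrome calculus).  `S` an edge set on `Fin n`, `H` a family of
edge-disjoint triangles of `S` (a linear triple system whose pairs all lie in `S`), `X := S ∖ shadow H` the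
EXTRA edges.  Colourings are `c : Fin n → ZMod 3`.  The TRIANGLE KERNEL is
`K(H) := {c | ∀ h ∈ H, ∑_{v ∈ h} c v = 0}` (a proper colouring is rainbow on every triangle, `0+1+2 = 0`,
so `COL(S) ⊆ K(H)`; by `flow_vanishes_at_defect` the rows are independent when `S` is 4-edge-critical, so
`dim K(H) = n − |H|`).  For an extra edge `e = {u,v}` let `φ_e(c) := c u − c v`, a linear functional on `K(H)`.

EXACT CALCULUS (paper, each line elementary):
* `COL(S) = {c ∈ K(H) : c rainbow on every h ∈ H, φ_e(c) ≠ 0 ∀ e ∈ X}`;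
* `S` dark ⟺ the hyperplanes `ker φ_e (e ∈ X)` together with the "constancy" sub-spaces of the triangles
  cover `K(H)`;
* an extra edge `e ∈ X` is critical ⟺ `ker φ_e` has a PRIVATE POINT: some `c ∈ K(H)`, rainbow on all of `H`,
  with `φ_e(c) = 0` and `φ_{e'}(c) ≠ 0` for every other `e' ∈ X` (this is `privatePoint_of_critical` below);
* a triangle edge `pq ⊂ h₀` is critical ⟺ the AFFINE coset `{c : M_H c = ±e_{h₀}}` contains a point proper on
  `S − pq` (a translate non-cover condition).

PRIVATE-POINT BOUND (`PrivatePointBound`, polynomial method over `𝔽₃`): if vectors `d₁,…,d_N ∈ 𝔽₃^m` admit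
private points `x_i` (`⟨x_i,d_i⟩ = 0`, `⟨x_i,d_j⟩ ≠ 0` for `j ≠ i`) then `N ≤ (m+1)(m+2)/2`: the functions
`f_i(y) = 1 − ⟨d_i,y⟩²` satisfy `f_i(x_j) = δ_{ij}`, are linearly independent, and lie in the span of the
`(m+1)(m+2)/2` monomials of degree `≤ 2`.  It is tight up to a constant: the ISOTROPIC, pairwise
non-orthogonal family `d_{ij} = 𝟙_{{0,i,j}}` (`1 ≤ i < j < m`) has `x_{ij} = d_{ij}` as private points,
`N = (m−1)(m−2)/2`.  GRAPH COROLLARY (`TrianglePackingSparsity`): in a 4-edge-critical edge set the number of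
edges outside any edge-disjoint triangle family `H` is at most `(k+1)(k+2)/2`, `k = dim K(H)` (`= n − |H|`):
a triangle packing of size `n − k` forces `|S| ≤ 3(n−k) + (k+1)(k+2)/2`, i.e. half-dense members
(`|S| ≥ (3+η)n`) have `ν_△ ≤ n − √(2ηn) + O(1)`.  This replaces the first-moment sentence of
RESULTS-r2s2g12 §2 («k ≥ 1.41 n, impossible») — which bounds GENERIC extra edges, `|X| ≲ 2.71 k` — by a
theorem valid for DESIGNED ones, and shows the designed optimum is quadratically larger (`|X| ≈ k²/2`):
the "XOR-SAT road" is closed by counting only for random-like difference families; for designed families it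
is closed by REALISABILITY (census §2.3: the `2n` difference vectors must each satisfy ≈ `u·log₂3`,
`u ≥ 2√n`, bits of linear constraints, while a random-like point set `λ(V) ⊂ 𝔽₃^k` offers only `n²`
differences — so `H` itself must be an algebraic design, and none with a critical shadow is known at any `n`).
-/

set_option linter.dupNamespace false
set_option autoImplicit false

namespace Summit.PneNP.PneNP.Cruxes.FoolingMeasure.IdeasR2s1g23

open Finset
open Summit.PneNP.PneNP.Theorems.AeaCutRectanglesCriticalSupport (IsEdgeCritical)

variable {n : ℕ}

/-- The triangle kernel `K(H) = {c : Fin n → ZMod 3 | every triple of H has colour-sum 0}` as a submodule. -/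
def triangleKernel (H : Finset (Finset (Fin n))) : Submodule (ZMod 3) (Fin n → ZMod 3) where
  carrier := {c | ∀ h ∈ H, ∑ v ∈ h, c v = 0}
  add_mem' := by
    intro a b ha hb h hh
    simp only [Set.mem_setOf_eq] at ha hb ⊢
    simp [Pi.add_apply, Finset.sum_add_distrib, ha h hh, hb h hh]
  zero_mem' := by
    intro h hh
    simp
  smul_mem' := by
    intro r c hc h hh
    simp only [Set.mem_setOf_eq] at hc ⊢
    simp [Pi.smul_apply, smul_eq_mul, ← Finset.mul_sum, hc h hh]

/-- A rainbow (injective) `ZMod 3`-colouring of a 3-set has colour-sum `0`. -/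
theorem sum_eq_zero_of_injOn_card_three (h : Finset (Fin n)) (hcard : h.card = 3) (c : Fin n → ZMod 3)
    (hinj : Set.InjOn c (h : Set (Fin n))) : ∑ v ∈ h, c v = 0 := by
  classical
  -- the image of `h` under `c` is all of `ZMod 3`
  have himg : (h.image c).card = 3 := by
    rw [Finset.card_image_of_injOn hinj, hcard]
  have huniv : h.image c = Finset.univ := by
    apply Finset.eq_univ_of_card
    simpa [ZMod.card] using himg
  calc ∑ v ∈ h, c v = ∑ x ∈ h.image c, x := by
        rw [Finset.sum_image]
        intro a ha b hb hab
        exact hinj ha hb hab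
    _ = ∑ x : ZMod 3, x := by rw [huniv]
    _ = 0 := by decide

/-- PROPER COLOURINGS LIE IN THE KERNEL: if `c` (read in `ZMod 3`) is a proper colouring of the graph spanned
by `S` and every pair of every triple of `H` is an edge of `S`, then `c ∈ K(H)`. -/
theorem mem_triangleKernel_of_proper (S : Finset (Sym2 (Fin n))) (H : Finset (Finset (Fin n)))
    (h3 : ∀ h ∈ H, h.card = 3)
    (hHS : ∀ h ∈ H, ∀ u ∈ h, ∀ v ∈ h, u ≠ v → s(u, v) ∈ S)
    (c : Fin n → ZMod 3)
    (hproper : ∀ u v : Fin n, s(u, v) ∈ S → u ≠ v → c u ≠ c v) :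
    c ∈ triangleKernel H := by
  intro h hh
  apply sum_eq_zero_of_injOn_card_three h (h3 h hh) c
  intro u hu v hv huv
  by_contra hne
  exact hproper u v (hHS h hh u hu v hv hne) hne huv

/-- A family of vectors `d i ∈ 𝔽₃^m` HAS PRIVATE POINTS if every `d i` has a vector orthogonal to it and to
no other member of the family. -/
def HasPrivatePoints {ι : Type*} {m : ℕ} (d : ι → (Fin m → ZMod 3)) : Prop :=
  ∀ i, ∃ x : Fin m → ZMod 3, (∑ a, x a * d i a) = 0 ∧ ∀ j, j ≠ i → (∑ a, x a * d j a) ≠ 0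

/-- DESIGN LEMMA (statement; polynomial method): a private-point family in `𝔽₃^m` has at most
`(m+1)(m+2)/2` members. -/
def PrivatePointBound : Prop :=
  ∀ (m N : ℕ) (d : Fin N → (Fin m → ZMod 3)), HasPrivatePoints d → N ≤ (m + 1) * (m + 2) / 2

/-- Tightness witness (statement): for every `m` the isotropic triple family `𝟙_{{0,i,j}}`, `0 < i < j < m`,
has private points (namely itself), so `PrivatePointBound` is sharp up to the factor `(m−1)(m−2)` vs
`(m+1)(m+2)`. -/
def IsotropicTriplesPrivate : Prop :=
  ∀ m : ℕ, HasPrivatePoints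
    (fun (p : {q : Fin m × Fin m // (0 : ℕ) < q.1.val ∧ q.1 < q.2}) (a : Fin m) =>
      if a.val = 0 ∨ a = p.1.1 ∨ a = p.1.2 then (1 : ZMod 3) else 0)

/-- CRITICAL EXTRA EDGES GIVE PRIVATE POINTS (proved): if `S` is 4-edge-critical, all pairs of the triples of
`H` lie in `S`, and `e = s(u,v) ∈ S` is an extra edge, then a proper colouring of `S.erase e` (read in `ZMod 3`)
is a kernel vector with `c u = c v` that separates the ends of every other edge of `S`. -/
theorem privatePoint_of_critical (S : Finset (Sym2 (Fin n))) (H : Finset (Finset (Fin n)))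
    (hS : IsEdgeCritical S) (h3 : ∀ h ∈ H, h.card = 3)
    (hHS : ∀ h ∈ H, ∀ u ∈ h, ∀ v ∈ h, u ≠ v → s(u, v) ∈ S)
    (u v : Fin n) (huv : u ≠ v) (he : s(u, v) ∈ S)
    (hX : ∀ h ∈ H, ¬ (u ∈ h ∧ v ∈ h)) :
    ∃ c : Fin n → ZMod 3, c ∈ triangleKernel H ∧ c u = c v ∧
      ∀ u' v' : Fin n, s(u', v') ∈ S → s(u', v') ≠ s(u, v) → u' ≠ v' → c u' ≠ c v' := by
  classical
  obtain ⟨hloop, hdark, hcrit⟩ := hS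
  obtain ⟨C⟩ := hcrit _ he
  -- read the colouring in ZMod 3
  let c : Fin n → ZMod 3 := fun w => ((C w : Fin 3) : ZMod 3)
  have cinj : ∀ a b : Fin n, c a = c b → C a = C b := by
    intro a b hab
    have : ((C a : Fin 3) : ZMod 3) = ((C b : Fin 3) : ZMod 3) := hab
    exact_mod_cast this
  -- properness on S.erase e
  have hprop : ∀ u' v' : Fin n, s(u', v') ∈ S.erase s(u, v) → u' ≠ v' → c u' ≠ c v' := by
    intro u' v' hm hne hc
    have hadj : (SimpleGraph.fromEdgeSet ((S.erase s(u, v) : Finset (Sym2 (Fin n))) : Set (Sym2 (Fin n)))).Adj u' v' := by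
      rw [SimpleGraph.fromEdgeSet_adj]
      exact ⟨by exact_mod_cast hm, hne⟩
    exact C.valid hadj (cinj _ _ hc)
  refine ⟨c, ?_, ?_, ?_⟩
  · -- kernel membership: every triple's pairs other than `e` are in `S.erase e`; `e` is not inside a triple
    intro h hh
    apply sum_eq_zero_of_injOn_card_three h (h3 h hh) c
    intro a ha b hb hab
    by_contra hne
    have hab' : s(a, b) ∈ S.erase s(u, v) := by
      refine Finset.mem_erase.2 ⟨?_, hHS h hh a ha b hb hne⟩
      intro heq
      rcases Sym2.eq_iff.1 heq with ⟨rfl, rfl⟩ | ⟨rfl, rfl⟩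
      · exact hX h hh ⟨ha, hb⟩
      · exact hX h hh ⟨hb, ha⟩
    exact hprop a b hab' hne hab
  · -- `c u = c v`: otherwise `c` would properly colour all of `S`, contradicting darkness
    by_contra hne
    apply hdark
    refine ⟨SimpleGraph.Coloring.mk (fun w => C w) ?_⟩
    intro a b hadj
    rw [SimpleGraph.fromEdgeSet_adj] at hadj
    obtain ⟨hab, hne'⟩ := hadj
    have hab : s(a, b) ∈ S := by exact_mod_cast hab
    by_cases heq : s(a, b) = s(u, v)
    · intro hC
      apply hne
      rcases Sym2.eq_iff.1 heq with ⟨rfl, rfl⟩ | ⟨rfl, rfl⟩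
      · simp [c, hC]
      · simp [c, hC]
    · intro hC
      exact hprop a b (Finset.mem_erase.2 ⟨heq, hab⟩) hne' (by simp [c, hC])
  · intro u' v' hm hne hne'
    exact hprop u' v' (Finset.mem_erase.2 ⟨hne, hm⟩) hne'


/-! ## The private-point bound, proved in the weaker form `N ≤ m² + 1`

Polynomial method: `F_i(y) = 1 − ⟨y,d_i⟩²` evaluates to the Kronecker delta on the private points, so the
`F_i` are linearly independent; each is a combination of the constant function and the `m²` products
`y_a y_b`.  (The sharp `(m+1)(m+2)/2` uses unordered pairs; the census only needs `m ≥ √(N−1)`.) -/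

section PolynomialMethod

variable {m N : ℕ}

/-- Non-zero elements of `ZMod 3` square to `1`. -/
theorem mul_self_eq_one_of_ne_zero (t : ZMod 3) (ht : t ≠ 0) : t * t = 1 := by
  revert ht; revert t; decide

/-- The evaluation functions of the polynomial method. -/
def evalFn (d : Fin N → (Fin m → ZMod 3)) (i : Fin N) : (Fin m → ZMod 3) → ZMod 3 :=
  fun y => 1 - (∑ a, y a * d i a) * (∑ a, y a * d i a)

/-- The spanning monomials: the constant `1` and the products `y a * y b`. -/
def monoFn (m : ℕ) : Option (Fin m × Fin m) → ((Fin m → ZMod 3) → ZMod 3)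
  | none => fun _ => 1
  | some p => fun y => y p.1 * y p.2

theorem evalFn_eq (d : Fin N → (Fin m → ZMod 3)) (i : Fin N) :
    evalFn d i = monoFn m none - ∑ p : Fin m × Fin m, (d i p.1 * d i p.2) • monoFn m (some p) := by
  funext y
  simp only [evalFn, monoFn, Pi.sub_apply, Finset.sum_apply, Pi.smul_apply, smul_eq_mul]
  rw [Finset.sum_mul_sum, Fintype.sum_prod_type]
  congr 1
  refine Finset.sum_congr rfl fun a _ => Finset.sum_congr rfl fun b _ => ?_
  ring

theorem evalFn_mem_span (d : Fin N → (Fin m → ZMod 3)) (i : Fin N) :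
    evalFn d i ∈ Submodule.span (ZMod 3) (Set.range (monoFn m)) := by
  rw [evalFn_eq]
  refine Submodule.sub_mem _ (Submodule.subset_span ⟨none, rfl⟩) ?_
  refine Submodule.sum_mem _ fun p _ => ?_
  exact Submodule.smul_mem _ _ (Submodule.subset_span ⟨some p, rfl⟩)

theorem evalFn_apply_private (d : Fin N → (Fin m → ZMod 3)) (x : Fin N → (Fin m → ZMod 3))
    (hx : ∀ i, (∑ a, x i a * d i a) = 0 ∧ ∀ j, j ≠ i → (∑ a, x i a * d j a) ≠ 0) (i j : Fin N) :
    evalFn d i (x j) = if i = j then 1 else 0 := by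
  unfold evalFn
  by_cases hij : i = j
  · subst hij
    simp [(hx i).1]
  · have hne : (∑ a, x j a * d i a) ≠ 0 := (hx j).2 i hij
    rw [if_neg hij, mul_self_eq_one_of_ne_zero _ hne]
    simp

theorem evalFn_linearIndependent (d : Fin N → (Fin m → ZMod 3)) (x : Fin N → (Fin m → ZMod 3))
    (hx : ∀ i, (∑ a, x i a * d i a) = 0 ∧ ∀ j, j ≠ i → (∑ a, x i a * d j a) ≠ 0) :
    LinearIndependent (ZMod 3) (evalFn d) := by
  classical
  rw [linearIndependent_iff']
  intro s g hg i hi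
  have key := congrFun hg (x i)
  simp only [Finset.sum_apply, Pi.smul_apply, smul_eq_mul, Pi.zero_apply] at key
  rw [Finset.sum_eq_single i] at key
  · simpa [evalFn_apply_private d x hx] using key
  · intro j _ hji
    rw [evalFn_apply_private d x hx]
    simp [hji]
  · intro hi'
    exact absurd hi hi'

/-- THE PRIVATE-POINT BOUND (weak form, proved): a private-point family in `𝔽₃^m` has at most `m² + 1`
members. -/
theorem privatePoint_bound_sq (d : Fin N → (Fin m → ZMod 3)) (h : HasPrivatePoints d) :
    N ≤ m * m + 1 := by
  classical
  choose x hx using h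
  set P : Submodule (ZMod 3) ((Fin m → ZMod 3) → ZMod 3) :=
    Submodule.span (ZMod 3) (Set.range (monoFn m)) with hP
  let v : Fin N → P := fun i => ⟨evalFn d i, evalFn_mem_span d i⟩
  have hv : LinearIndependent (ZMod 3) v := by
    apply LinearIndependent.of_comp P.subtype
    exact evalFn_linearIndependent d x hx
  haveI : Module.Finite (ZMod 3) P := Module.Finite.span_of_finite (ZMod 3) (Set.finite_range _)
  have h2 : Fintype.card (Fin N) ≤ Module.finrank (ZMod 3) P := hv.fintype_card_le_finrank
  have h3 : Module.finrank (ZMod 3) P ≤ Fintype.card (Option (Fin m × Fin m)) :=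
    finrank_range_le_card (R := ZMod 3) (monoFn m)
  simp only [Fintype.card_fin, Fintype.card_option, Fintype.card_prod] at h2 h3
  omega

/-- The same bound for an arbitrary finite index type (reindex along `Fintype.equivFin`). -/
theorem card_le_of_hasPrivatePoints {ι : Type*} [Fintype ι] (d : ι → (Fin m → ZMod 3))
    (h : HasPrivatePoints d) : Fintype.card ι ≤ m * m + 1 := by
  classical
  let e := (Fintype.equivFin ι).symm
  have h' : HasPrivatePoints (fun i : Fin (Fintype.card ι) => d (e i)) := by
    intro i
    obtain ⟨x, hx0, hx1⟩ := h (e i)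
    refine ⟨x, hx0, fun j hj => hx1 (e j) ?_⟩
    intro hij
    exact hj (e.injective hij)
  exact privatePoint_bound_sq _ h'

end PolynomialMethod

/-- GRAPH COROLLARY (statement): in a 4-edge-critical edge set, the edges outside an edge-disjoint triangle
family `H` (all of whose pairs are edges) number at most `(k+1)(k+2)/2`, `k = dim_{𝔽₃} K(H)`.  With
`CriticalTrianglePackingsAcyclic` (rows independent) `k = n − |H|`.  Proof route: `privatePoint_of_critical`
for every extra edge, restrict the functionals `c ↦ c u − c v` to `K(H) ≅ 𝔽₃^k`, apply `PrivatePointBound`. -/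
def TrianglePackingSparsity : Prop :=
  ∀ (n : ℕ) (S : Finset (Sym2 (Fin n))) (H : Finset (Finset (Fin n))),
    IsEdgeCritical S → (∀ h ∈ H, h.card = 3) →
    (∀ h ∈ H, ∀ h' ∈ H, h ≠ h' → (h ∩ h').card ≤ 1) →
    (∀ h ∈ H, ∀ u ∈ h, ∀ v ∈ h, u ≠ v → s(u, v) ∈ S) →
    S.card - 3 * H.card ≤
      (Module.finrank (ZMod 3) (triangleKernel H) + 1) * (Module.finrank (ZMod 3) (triangleKernel H) + 2) / 2

/-- GRAPH COROLLARY (proved, weak constant): in a 4-edge-critical edge set `S` containing all pairs of a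
family `H` of triples, any injectively listed family of `N` edges of `S` none of which lies inside a triple
of `H` has `N ≤ m² + 1`, `m = dim_{𝔽₃} triangleKernel H`.  With `H` a linear (pairwise edge-disjoint)
triangle family this reads `|S| − 3|H| ≤ m² + 1`: kernel dimension `m` buys at most `m² + 1` critical
extra edges (census §2.2; the generic count allows only `≈ 2.71·m`, isotropic designs reach `≈ m²/2`). -/
theorem extraEdges_le_sq (S : Finset (Sym2 (Fin n))) (H : Finset (Finset (Fin n)))
    (hS : IsEdgeCritical S) (h3 : ∀ h ∈ H, h.card = 3)
    (hHS : ∀ h ∈ H, ∀ u ∈ h, ∀ v ∈ h, u ≠ v → s(u, v) ∈ S)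
    {N : ℕ} (u v : Fin N → Fin n) (hne : ∀ i, u i ≠ v i) (hinS : ∀ i, s(u i, v i) ∈ S)
    (hinj : Function.Injective fun i => s(u i, v i))
    (hXH : ∀ i, ∀ h ∈ H, ¬ (u i ∈ h ∧ v i ∈ h)) :
    N ≤ Module.finrank (ZMod 3) (triangleKernel H) * Module.finrank (ZMod 3) (triangleKernel H) + 1 := by
  classical
  set K := triangleKernel H with hK
  let b := Module.finBasis (ZMod 3) K
  have hc : ∀ i, ∃ c : Fin n → ZMod 3, c ∈ K ∧ c (u i) = c (v i) ∧
      ∀ u' v' : Fin n, s(u', v') ∈ S → s(u', v') ≠ s(u i, v i) → u' ≠ v' → c u' ≠ c v' :=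
    fun i => privatePoint_of_critical S H hS h3 hHS (u i) (v i) (hne i) (hinS i) (hXH i)
  choose c hcK hcuv hcprop using hc
  let d : Fin N → (Fin (Module.finrank (ZMod 3) K) → ZMod 3) :=
    fun i a => ((b a : K) : Fin n → ZMod 3) (u i) - ((b a : K) : Fin n → ZMod 3) (v i)
  have h1 : ∀ i (w : Fin n),
      (∑ a, (b.equivFun ⟨c i, hcK i⟩) a * ((b a : K) : Fin n → ZMod 3) w) = c i w := by
    intro i w
    have hsum : ((∑ a, (b.equivFun ⟨c i, hcK i⟩) a • b a : K) : Fin n → ZMod 3) w = c i w := by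
      rw [b.sum_equivFun]
    rw [Submodule.coe_sum, Finset.sum_apply] at hsum
    simpa only [Submodule.coe_smul, Pi.smul_apply, smul_eq_mul] using hsum
  have key : ∀ i j, (∑ a, (b.equivFun ⟨c i, hcK i⟩) a * d j a) = c i (u j) - c i (v j) := by
    intro i j
    simp only [d, mul_sub, Finset.sum_sub_distrib, h1]
  have hpp : HasPrivatePoints d := by
    intro i
    refine ⟨b.equivFun ⟨c i, hcK i⟩, ?_, ?_⟩
    · rw [key, hcuv i, sub_self]
    · intro j hj h0
      rw [key] at h0
      have hneq : s(u j, v j) ≠ s(u i, v i) := by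
        intro heq
        exact hj (hinj heq)
      exact hcprop i (u j) (v j) (hinS j) hneq (hne j) (sub_eq_zero.mp h0)
  have := card_le_of_hasPrivatePoints d hpp
  simpa using this

/-- REALISABILITY WALL, counting core (statement): if `x₁,…,x_r ∈ 𝔽₃^m` are linearly independent, exactly
`2^r · 3^(m−r)` vectors are non-orthogonal to all of them (the map `z ↦ (⟨x_i,z⟩)_i` is onto `𝔽₃^r` with
uniform fibres).  Used in census §2.3: the admissible differences of a private-point configuration with `N`
members have density `≤ ⅓·(2/3)^(√(2N)−4)`, far below `n⁻²` — a pseudo-random point set realises none. -/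
def NonOrthogonalCount : Prop :=
  ∀ (m r : ℕ) (x : Fin r → (Fin m → ZMod 3)), LinearIndependent (ZMod 3) x →
    (Finset.univ.filter (fun z : Fin m → ZMod 3 => ∀ i, (∑ a, z a * x i a) ≠ 0)).card = 2 ^ r * 3 ^ (m - r)

end Summit.PneNP.PneNP.Cruxes.FoolingMeasure.IdeasR2s1g23
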